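import Literature.IUT.HodgeTheaters.PMBaseProcessions

/-!
# Proofs for [IUTchI] Proposition 6.9 (i)–(iii) and Corollary 6.10 (iv): the label bijection `|T| ⥲ |𝔽_l|`, the procession counts, and the §4-compatibilities

Mochizuki, *Inter-universal Teichmüller theory I*, §6, Proposition 6.9 (i)–(iii) pp. 169–170 and
Corollary 6.10 (iv) p. 172, kurims manuscript (May 2020). PROOF-ONLY companion (theorems, no
definitions) to abc-iut-L5-t4's `PMBaseProcessions.lean`, by the wave-4 discharge seat abc-iut-w4-d076
(DAG nodes IUTchI:Prop6.9(i), IUTchI:Prop6.9(ii), IUTchI:Prop6.9(iii), IUTchI:Cor6.10(iv)).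

What is PROVED here, for every `𝒟-Θ^±`-bridge `†φ^{Θ±}_± : †𝔇_T → †𝔇_≻` over every base kit with `l` odd:

* Def 6.4 (i) / Prop 6.9 (i): the labels `|t| ↦ absLabel |t| ∈ {0, 1, …, l^± − 1}` "relative to the
  bijection `|T| ⥲ |𝔽_l|` determined by the `𝔽_l^±`-group structure of `T`" form a BIJECTION
  `|T| ⥲ {0, …, l^± − 1}` (`absLabel_injective`, `exists_absLabel_eq`, `exists_equiv_fin_absLabel`),
  `|T|` has `l^± = (l+1)/2` elements (`card_abs`) and `T^⋇` has `l^⋇ = (l−1)/2` (`card_absStar`);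
* Prop 6.9 (i), the count ON THE OBJECTS (t4's `procession_count` is the bare arithmetic
  `∏ (n+1) = m!`): the index set `{q ∈ |T| : label(q) < n}` of the `n`-capsule of `Prc(†𝔇_T)`
  (`DThetaPMBridge.procession n`) has EXACTLY `n` elements for `n ≤ l^±` — "there are precisely `n`
  possibilities for the element `∈ |𝔽_l|` to which a given index of the index set of the `n`-capsule
  … corresponds" (`card_procession_idx`); the top capsule is all of `†𝔇_{|T|}` (`absLabel_lt`), and
  likewise the `j`-capsule of the `l^⋇`-procession of the `𝒟-Θ`-bridge `†𝔇_{T^⋇} → †𝔇_>` of Prop 6.7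
  has exactly `j` constituents (`card_starProcession_idx`) — the same counts hold verbatim for the
  mono-analyticized processions of Prop 6.9 (ii) (same index sets, `monoProcession`);
* Prop 6.9 (iii): the named statement `DThetaPMBridge.ProcessionCompat`, typed with the Prop 4.11 (i)
  procession functor as a PARAMETER, HOLDS for the parameter instantiated by the Prop 4.11 (i) recipe
  applied to the output `†φ^Θ_⋆ = thetaBridgeData` of the functorial algorithm of Prop 6.7 (the
  `j`-capsule of `Prc(†𝔇_{T^⋇})` = the sub-capsule of `†𝔇_{T^⋇}` on the classes of label `≤ j`): its
  constituents are literally those of the `(j+1)`-capsule of `Prc(†𝔇_T)` (`processionCompat_thetaBridgeData`);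
* Cor 6.10 (iv), constructions (i): the named statement `DThetaPMEllHT.CoreCompat`, typed with the
  Cor 4.12 (i) functor `†ℋ𝒯 ↦ †𝔇_> ↦ †𝔇^⊢_>` as a PARAMETER, HOLDS for that functor transcribed on the
  `𝒟-Θ`-bridge data of Prop 6.7 ("the mono-analyticization of the `𝒟`-prime-strip that appears as the
  codomain", `D ↦ M.mono D.codomain`): the coric `𝒟^⊢`-prime-strip of the `𝒟-Θ^{±ell}`-link is the one
  Cor 4.12 (i) assigns to the associated `𝒟-Θ`-bridge (`coreCompat_monoCodomain`), hence the links and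
  étale-pictures of Cor 6.10 (ii), (iii) built from it agree with those of Cor 4.12 (ii), (iii)
  (`dLink_eq_of_coreCompat`).

Record only; [claim: Mochizuki2012, status: disputed]; nothing here takes a side on any disputed step.
-/

namespace Literature.IUT.HodgeTheaters

open CategoryTheory

universe u

/-! ### Least natural representatives up to sign in `𝔽_l` -/

namespace ZModAbsLabel

variable {l : ℕ}

/-- For `l` odd and `z ∈ 𝔽_l`, `min(|z|, |−z|) ≤ (l − 1)/2`, where `|·|` is the least natural
representative. [folklore] -/
private theorem min_val_le (hl : Odd l) (z : ZMod l) : min z.val (-z).val ≤ (l - 1) / 2 := by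
  haveI : NeZero l := ⟨by rintro rfl; exact (Nat.not_odd_zero hl).elim⟩
  obtain ⟨k, hk⟩ := hl
  rw [ZMod.neg_val]
  split_ifs with hz
  · simp
  · have := ZMod.val_lt z
    rcases le_total z.val (l - z.val) with h | h
    · rw [min_eq_left h]; omega
    · rw [min_eq_right h]; omega

/-- In `𝔽_l` (`l ≠ 0`), `min(|z|, |−z|) = min(|w|, |−w|)` forces `w = ±z`. [folklore] -/
private theorem eq_or_eq_neg_of_min_val_eq [NeZero l] {z w : ZMod l}
    (h : min z.val (-z).val = min w.val (-w).val) : w = z ∨ w = -z := by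
  have hi := ZMod.val_injective l
  rcases min_choice z.val (-z).val with hz | hz <;> rcases min_choice w.val (-w).val with hw | hw <;>
    rw [hz, hw] at h
  · exact Or.inl (hi h).symm
  · exact Or.inr (by rw [hi h, neg_neg])
  · exact Or.inr (hi h).symm
  · exact Or.inl (neg_injective (hi h)).symm

/-- For `l` odd and `n ≤ (l − 1)/2`, the class of `n` in `𝔽_l` satisfies `min(|n|, |−n|) = n`.
[folklore] -/
private theorem min_val_natCast (hl : Odd l) {n : ℕ} (hn : n ≤ (l - 1) / 2) :
    min (n : ZMod l).val (-(n : ZMod l)).val = n := by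
  haveI : NeZero l := ⟨by rintro rfl; exact (Nat.not_odd_zero hl).elim⟩
  obtain ⟨k, hk⟩ := hl
  have hnl : n < l := by omega
  rw [ZMod.val_natCast_of_lt hnl, ZMod.neg_val]
  split_ifs with h0
  · have h : n = 0 := by
      have := congrArg ZMod.val h0
      rwa [ZMod.val_natCast_of_lt hnl, ZMod.val_zero] at this
    subst h
    simp
  · rw [ZMod.val_natCast_of_lt hnl]
    exact min_eq_left (by omega)

end ZModAbsLabel

/-! ### Classes `|t| ∈ |T|` of an `𝔽_l^±`-group -/

namespace FlPMGroup

variable {l : ℕ} {E : Type*} (S : FlPMGroup l E)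

/-- Two elements of an `𝔽_l^±`-group have the same class in `|T| = T/{±1}` iff they agree up to sign
([IUTchI] Def 6.4 (i) p. 162). [claim: Mochizuki2012, status: disputed] -/
theorem toAbs_eq_toAbs_iff (t t' : E) : S.toAbs t = S.toAbs t' ↔ t' = t ∨ t' = S.neg t :=
  ⟨fun h => Quotient.exact h, fun h => Quotient.sound h⟩

/-- `|−t| = |t|` ([IUTchI] Def 6.4 (i) p. 162). [claim: Mochizuki2012, status: disputed] -/
theorem toAbs_neg (t : E) : S.toAbs (S.neg t) = S.toAbs t :=
  ((S.toAbs_eq_toAbs_iff t (S.neg t)).2 (Or.inr rfl)).symm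

/-- Every class in `|T|` has a representative ([IUTchI] Def 6.4 (i) p. 162).
[claim: Mochizuki2012, status: disputed] -/
theorem toAbs_surjective : Function.Surjective S.toAbs := fun q => ⟨Quotient.out q, Quotient.out_eq q⟩

/-- The chosen representative of `|t|` is `t` or `−t` ([IUTchI] Def 6.4 (i) p. 162).
[claim: Mochizuki2012, status: disputed] -/
theorem out_toAbs (t : E) :
    Quotient.out (S.toAbs t) = t ∨ Quotient.out (S.toAbs t) = S.neg t := by
  have h : t = Quotient.out (S.toAbs t) ∨ t = S.neg (Quotient.out (S.toAbs t)) :=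
    Quotient.exact (Quotient.out_eq (S.toAbs t))
  rcases h with h | h
  · exact Or.inl h.symm
  · have h' := congrArg S.neg h
    rw [S.neg_neg] at h'
    exact Or.inr h'.symm

end FlPMGroup

namespace PMBaseKit

variable {l : ℕ} {K : PMBaseKit.{u} l}

namespace DThetaPMBridge

variable (B : K.DThetaPMBridge)

/-! ### The labels `|T| → {0, 1, …, l^± − 1}` (Def 6.4 (i), Prop 6.9 (i)) -/

/-- The label of a class, by definition: `min(|e(t₀)|, |−e(t₀)|)` for the chosen representative `t₀`
and the chosen chart `e` ([IUTchI] Prop 6.9 (i) p. 169). [claim: Mochizuki2012, status: disputed] -/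
theorem absLabel_eq (q : B.grpT.Abs) :
    B.absLabel q =
      min (B.grpT.chart₀ (Quotient.out q)).val (-(B.grpT.chart₀ (Quotient.out q))).val := rfl

/-- The label of `|t|` may be read on ANY representative `t`: `label(|t|) = min(|e(t)|, |−e(t)|)` —
independent of the representative since `e(−t) = −e(t)` ([IUTchI] Def 6.4 (i) p. 162: "independent of
the chart, which changes `e(t)` at most by a sign"). [claim: Mochizuki2012, status: disputed] -/
theorem absLabel_toAbs (t : B.T) :
    B.absLabel (B.grpT.toAbs t) = min (B.grpT.chart₀ t).val (-(B.grpT.chart₀ t)).val := by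
  rw [absLabel_eq]
  rcases B.grpT.out_toAbs t with h | h
  · rw [h]
  · rw [h, B.grpT.chart_neg B.grpT.chart₀_mem, neg_neg, min_comm]

/-- Every label lies in `{0, …, l^⋇}`, `l^⋇ = (l − 1)/2`, for `l` odd ([IUTchI] Def 6.4 (i) p. 162:
`|𝔽_l| = {0} ∪ 𝔽_l^⋇`). [claim: Mochizuki2012, status: disputed] -/
theorem absLabel_le (hl : Odd l) (q : B.grpT.Abs) : B.absLabel q ≤ (l - 1) / 2 :=
  ZModAbsLabel.min_val_le hl _

/-- Every label is `< l^± = (l + 1)/2`, for `l` odd — i.e. the `l^±`-capsule of `Prc(†𝔇_T)` is all of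
`†𝔇_{|T|}`: "`S^±_{l^±} = |𝔽_l|`" ([IUTchI] Prop 6.9 (i) p. 169). [claim: Mochizuki2012, status: disputed] -/
theorem absLabel_lt (hl : Odd l) (q : B.grpT.Abs) : B.absLabel q < (l + 1) / 2 := by
  have := B.absLabel_le hl q
  obtain ⟨k, hk⟩ := hl
  omega

/-- **Def 6.4 (i) / Prop 6.9 (i), injectivity of the labels**: distinct classes in `|T|` have distinct
labels in `|𝔽_l|` ("the bijection `|T| ⥲ |𝔽_l|` determined by the `𝔽_l^±`-group structure of `T`",
[IUTchI] Prop 6.9 (i) p. 169), for `l` odd. [claim: Mochizuki2012, status: disputed] -/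
theorem absLabel_injective (hl : Odd l) : Function.Injective B.absLabel := by
  haveI : NeZero l := ⟨by rintro rfl; exact (Nat.not_odd_zero hl).elim⟩
  intro q q' h
  obtain ⟨t, rfl⟩ := B.grpT.toAbs_surjective q
  obtain ⟨t', rfl⟩ := B.grpT.toAbs_surjective q'
  rw [absLabel_toAbs, absLabel_toAbs] at h
  rcases ZModAbsLabel.eq_or_eq_neg_of_min_val_eq h with h' | h'
  · rw [B.grpT.chart₀.injective h']
  · rw [← B.grpT.chart_neg B.grpT.chart₀_mem] at h'
    rw [B.grpT.chart₀.injective h', FlPMGroup.toAbs_neg]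

/-- **Def 6.4 (i) / Prop 6.9 (i), surjectivity of the labels**: every `n ∈ {0, …, l^⋇}` is the label of
some class in `|T|`, for `l` odd. [claim: Mochizuki2012, status: disputed] -/
theorem exists_absLabel_eq (hl : Odd l) {n : ℕ} (hn : n ≤ (l - 1) / 2) : ∃ q, B.absLabel q = n :=
  ⟨B.grpT.toAbs (B.grpT.chart₀.symm n), by
    rw [absLabel_toAbs, Equiv.apply_symm_apply]; exact ZModAbsLabel.min_val_natCast hl hn⟩

/-- The class of zero has label `0` ([IUTchI] Def 6.4 (i) p. 162). [claim: Mochizuki2012, status: disputed] -/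
theorem absLabel_toAbs_zero : B.absLabel (B.grpT.toAbs B.grpT.zero) = 0 := by
  rw [absLabel_toAbs, B.grpT.chart_zero B.grpT.chart₀_mem, neg_zero, ZMod.val_zero, min_self]

/-- The label `0` singles out the class of zero: `label(q) = 0 ↔ q = |0|`, so `T^⋇ = |T| ∖ {0}` is the
set of classes of NONZERO label ([IUTchI] Def 6.4 (i) p. 162), for `l` odd.
[claim: Mochizuki2012, status: disputed] -/
theorem absLabel_eq_zero_iff (hl : Odd l) (q : B.grpT.Abs) :
    B.absLabel q = 0 ↔ q = B.grpT.toAbs B.grpT.zero := by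
  constructor
  · intro h
    exact B.absLabel_injective hl (h.trans B.absLabel_toAbs_zero.symm)
  · rintro rfl
    exact B.absLabel_toAbs_zero

/-- **Def 6.4 (i) / Prop 6.9 (i), the bijection `|T| ⥲ |𝔽_l| = {0, 1, …, l^± − 1}`** determined by the
`𝔽_l^±`-group structure of `T` (via the labels), for `l` odd ([IUTchI] Prop 6.9 (i) p. 169).
[claim: Mochizuki2012, status: disputed] -/
theorem exists_equiv_fin_absLabel (hl : Odd l) :
    ∃ e : B.grpT.Abs ≃ Fin ((l + 1) / 2), ∀ q, (e q : ℕ) = B.absLabel q := by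
  refine ⟨Equiv.ofBijective (fun q => ⟨B.absLabel q, B.absLabel_lt hl q⟩) ⟨?_, ?_⟩, fun q => rfl⟩
  · intro q q' h
    exact B.absLabel_injective hl (congrArg Fin.val h)
  · intro i
    obtain ⟨q, hq⟩ := B.exists_absLabel_eq hl (n := i.val) (by
      have := i.2; obtain ⟨k, hk⟩ := hl; omega)
    exact ⟨q, Fin.ext hq⟩

/-- `|T|` has exactly `l^± = (l + 1)/2` elements ([IUTchI] Def 6.4 (i) p. 162: "`|𝔽_l|` of cardinality
`l^±`"), for `l` odd. [claim: Mochizuki2012, status: disputed] -/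
theorem card_abs (hl : Odd l) : Nat.card B.grpT.Abs = (l + 1) / 2 := by
  obtain ⟨e, -⟩ := B.exists_equiv_fin_absLabel hl
  exact Nat.card_eq_of_equiv_fin e

/-! ### Proposition 6.9 (i), (ii): the procession counts on the objects -/

/-- **Prop 6.9 (i), "precisely `n` possibilities"** ([IUTchI] p. 169): for `n ∈ {1, …, l^±}` the index
set `{q ∈ |T| : label(q) < n}` of the `n`-capsule of the `l^±`-procession `Prc(†𝔇_T)`
(`DThetaPMBridge.procession n`; the labels `S^±_n = {0, 1, …, n − 1}`) has EXACTLY `n` elements — so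
"there are precisely `n` possibilities for the element `∈ |𝔽_l|` to which a given index of the index
set of the `n`-capsule that appears in the procession … corresponds", and the product of these counts
is `l^±!` (t4's `procession_count`). For `l` odd. [claim: Mochizuki2012, status: disputed] -/
theorem card_procession_idx (hl : Odd l) {n : ℕ} (hn : n ≤ (l + 1) / 2) :
    Nat.card {q : B.grpT.Abs // B.absLabel q < n} = n := by
  obtain ⟨e, he⟩ := B.exists_equiv_fin_absLabel hl
  have hsymm : ∀ x, B.absLabel (e.symm x) = x.1 := fun x => by rw [← he, Equiv.apply_symm_apply]
  exact Nat.card_eq_of_equiv_fin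
    { toFun := fun q => ⟨B.absLabel q.1, q.2⟩
      invFun := fun i => ⟨e.symm ⟨i.1, lt_of_lt_of_le i.2 hn⟩, by rw [hsymm]; exact i.2⟩
      left_inv := fun q => Subtype.ext ((Equiv.symm_apply_eq e).2 (Fin.ext (he q.1).symm))
      right_inv := fun i => Fin.ext (hsymm _) }

/-- **Prop 6.9 (ii)** ([IUTchI] pp. 169–170): the mono-analyticized procession `Prc(†𝔇^⊢_T)`
(`monoProcession`) has the SAME index sets, hence "satisfies the same indeterminacy properties with
respect to labels": its `n`-capsule also has exactly `n` constituents, each the mono-analyticization of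
the corresponding constituent of `Prc(†𝔇_T)`. For `l` odd. [claim: Mochizuki2012, status: disputed] -/
theorem card_monoProcession_idx (M : K.MultKit) (hl : Odd l) {n : ℕ} (hn : n ≤ (l + 1) / 2) :
    Nat.card {q : B.grpT.Abs // B.absLabel q < n} = n ∧
      ∀ q : {q : B.grpT.Abs // B.absLabel q < n},
        B.monoProcession M n q = M.mono (B.procession n q) :=
  ⟨B.card_procession_idx hl hn, fun _ => rfl⟩

/-- The `j`-capsule of the `l^⋇`-procession of the `𝒟-Θ`-bridge `†φ^Θ_⋆ : †𝔇_{T^⋇} → †𝔇_>` of Prop 6.7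
(Prop 4.11 (i) recipe: the sub-capsule of `†𝔇_{T^⋇}` on the classes of label `∈ S^⋇_j = {1, …, j}`) has
EXACTLY `j` constituents, `j ∈ {1, …, l^⋇}` ([IUTchI] Prop 4.11 (i) p. 120 / Prop 6.9 (iii) p. 170), for
`l` odd. [claim: Mochizuki2012, status: disputed] -/
theorem card_starProcession_idx (hl : Odd l) {j : ℕ} (hj : j ≤ (l - 1) / 2) :
    Nat.card {q : B.grpT.AbsStar // B.absLabel q.1 ≤ j} = j := by
  obtain ⟨e, he⟩ := B.exists_equiv_fin_absLabel hl
  have hsymm : ∀ x, B.absLabel (e.symm x) = x.1 := fun x => by rw [← he, Equiv.apply_symm_apply]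
  have hk : (l - 1) / 2 + 1 = (l + 1) / 2 := by obtain ⟨k, hk⟩ := hl; omega
  have hpos : ∀ q : B.grpT.AbsStar, 1 ≤ B.absLabel q.1 := fun q => (B.absLabel_pos_le hl q).1
  have hlt : ∀ i : Fin j, i.1 + 1 < (l + 1) / 2 := fun i => by have := i.2; omega
  have hne : ∀ i : Fin j, e.symm ⟨i.1 + 1, hlt i⟩ ≠ B.grpT.toAbs B.grpT.zero := fun i h => by
    have h0 : B.absLabel (e.symm ⟨i.1 + 1, hlt i⟩) = i.1 + 1 := hsymm ⟨i.1 + 1, hlt i⟩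
    rw [h, absLabel_toAbs_zero] at h0
    exact Nat.succ_ne_zero _ h0.symm
  exact Nat.card_eq_of_equiv_fin
    { toFun := fun q => ⟨B.absLabel q.1.1 - 1, by have := hpos q.1; have := q.2; omega⟩
      invFun := fun i => ⟨⟨e.symm ⟨i.1 + 1, hlt i⟩, hne i⟩, by
        change B.absLabel (e.symm _) ≤ j; rw [hsymm]; exact Nat.succ_le_of_lt i.2⟩
      left_inv := fun q => Subtype.ext (Subtype.ext ((Equiv.symm_apply_eq e).2 (Fin.ext (by
        change B.absLabel q.1.1 - 1 + 1 = (e q.1.1 : ℕ)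
        rw [he, Nat.sub_add_cancel (hpos q.1)]))))
      right_inv := fun i => Fin.ext (by
        change B.absLabel (e.symm _) - 1 = i.1
        rw [hsymm]; exact Nat.add_sub_cancel i.1 1) }

/-- `T^⋇ = |T| ∖ {0}` has exactly `l^⋇ = (l − 1)/2` elements ([IUTchI] Def 6.4 (i) p. 162: "`T^⋇` … may be
naturally identified with `𝔽_l^⋇`"), for `l` odd. [claim: Mochizuki2012, status: disputed] -/
theorem card_absStar (hl : Odd l) : Nat.card B.grpT.AbsStar = lStar l := by
  rw [← Nat.card_congr (Equiv.subtypeUnivEquiv fun q : B.grpT.AbsStar => B.absLabel_le hl q.1)]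
  exact B.card_starProcession_idx hl le_rfl

/-! ### Proposition 6.9 (iii): compatibility with Proposition 4.11 relative to Proposition 6.7 -/

/-- **Prop 6.9 (iii)** ([IUTchI] p. 170), DISCHARGED for the functorial algorithm of Prop 6.7: the named
statement `ProcessionCompat` — typed in `PMBaseProcessions.lean` with the Prop 4.11 (i) procession as a
parameter `prc4` — holds when `prc4` is the Prop 4.11 (i) recipe ("the subcapsules … corresponding to
the subsets `S^⋇_1 ⊆ … ⊆ S^⋇_j := {1, …, j} ⊆ … ⊆ S^⋇_{l^⋇}`") applied to the `𝒟-Θ`-bridge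
`†φ^Θ_⋆ : †𝔇_{T^⋇} → †𝔇_>` produced by Prop 6.7 (`thetaBridgeData`): "the natural inclusions
`S^⋇_j = {1, …, j} ↪ S^±_t = {0, 1, …, t−1}` — where `t := j + 1` — determine natural transformations
`Prc(†𝔇_{T^⋇}) ↪ Prc(†𝔇_T)`": the constituent of the `j`-capsule of `Prc(†𝔇_{T^⋆})` at a class `q` IS the
constituent of the `(j+1)`-capsule of `Prc(†𝔇_T)` at `q`. [claim: Mochizuki2012, status: disputed] -/
theorem processionCompat_thetaBridgeData (M : K.MultKit) (hl : Odd l) :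
    DThetaPMBridge.ProcessionCompat K B (fun _ q => (B.thetaBridgeData M hl).capsule ⟨q.1⟩) :=
  fun _ _ => rfl

/-- Prop 6.9 (iii), mono-analytic half ([IUTchI] p. 170): likewise `Prc(†𝔇^⊢_{T^⋇}) ↪ Prc(†𝔇^⊢_T)` — the
mono-analyticization of the constituent of the `j`-capsule of `Prc(†𝔇_{T^⋇})` at `q` is the constituent of
the `(j+1)`-capsule of `Prc(†𝔇^⊢_T)` at `q` (Prop 6.9 (ii)'s `monoProcession`).
[claim: Mochizuki2012, status: disputed] -/
theorem monoProcessionCompat_thetaBridgeData (M : K.MultKit) (hl : Odd l) (j : ℕ)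
    (q : {q : B.grpT.AbsStar // B.absLabel q.1 ≤ j}) :
    M.mono ((B.thetaBridgeData M hl).capsule ⟨q.1⟩) =
      B.monoProcession M (j + 1) ⟨q.1.1, Nat.lt_succ_of_le q.2⟩ :=
  rfl

end DThetaPMBridge

/-! ### Corollary 6.10 (iv): compatibility with Corollary 4.12 relative to Proposition 6.7 -/

namespace DThetaPMEllHT

/-- **Cor 6.10 (iv)** ([IUTchI] p. 172), DISCHARGED for the functorial algorithm of Prop 6.7: the named
statement `CoreCompat` — typed in `PMBaseProcessions.lean` with the Cor 4.12 (i) functor as a parameter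
`core4` — holds when `core4` is the Cor 4.12 (i) functor "`†ℋ𝒯^{𝒟-ΘNF} ↦ †𝔇_> ↦ †𝔇^⊢_>`, the
mono-analyticization of the `𝒟`-prime-strip `†𝔇_>` that appears as the codomain of the underlying
`𝒟-Θ`-bridge" ([IUTchI] Cor 4.12 (i) p. 121) transcribed on `𝒟-Θ`-bridge data (`D ↦ M.mono D.codomain`):
the `𝒟^⊢`-prime-strip `†𝔇^⊢_>` of Cor 6.10 (i) — whose full poly-isomorphisms are the `𝒟-Θ^{±ell}`-links —
is the one Cor 4.12 (i) assigns to the `𝒟-Θ`-bridge associated via Prop 6.7 ("compatible … relative to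
the functor of Proposition 6.7, in the evident sense"). [claim: Mochizuki2012, status: disputed] -/
theorem coreCompat_monoCodomain (M : K.MultKit) (hl : Odd l) :
    DThetaPMEllHT.CoreCompat K M (fun D => M.mono D.codomain) hl :=
  fun _ => rfl

/-- Cor 6.10 (iv) for constructions (i)–(iii) ([IUTchI] p. 172): whenever the Cor 4.12 (i) functor `core4`
is compatible with Prop 6.7 (`CoreCompat`), the `𝒟-Θ^{±ell}`-link `†𝔇^⊢_> ⥲ ‡𝔇^⊢_>` of Cor 6.10 (i) — hence
the chains / mono-analytic cores of (ii) and the étale-pictures of (iii), which are assembled from these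
links — is the full poly-isomorphism between the values of `core4` on the associated `𝒟-Θ`-bridges,
i.e. the `𝒟`-ΘNF-link recipe of Cor 4.12 (i) applied to them. [claim: Mochizuki2012, status: disputed] -/
theorem dLink_eq_of_coreCompat (M : K.MultKit) (hl : Odd l) {core4 : K.DThetaBridgeData → M.DMono}
    (h : DThetaPMEllHT.CoreCompat K M core4 hl) (H₁ H₂ : K.DThetaPMEllHT) :
    core4 (H₁.pmBridge.thetaBridgeData M hl) = monoCore M H₁ ∧
      core4 (H₂.pmBridge.thetaBridgeData M hl) = monoCore M H₂ ∧
        dLink M H₁ H₂ = (Set.univ : Set (monoCore M H₁ ⟶ monoCore M H₂)) :=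
  ⟨h H₁, h H₂, rfl⟩

end DThetaPMEllHT

end PMBaseKit

end Literature.IUT.HodgeTheaters
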